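import Literature.NumberTheory.Automorphic.HidaLevelUnipotentCosets
import Literature.NumberTheory.Automorphic.LevelActionInducedCoefficients
import Mathlib.Topology.Algebra.OpenSubgroup
import HarnessLib

/-!
# The unipotent representatives `N(x) t_v^a` form an adapted family for `U(c,c) ⊴ U(b',c)`

Topic `NumberTheory/Automorphic`; namespace `Literature.NumberTheory.Automorphic.BigHeckeGLn`.
One auxiliary definition (`TameLevel.unipotentRep`, a chosen integral `x` with `N(x) t^a U = d`
for each coset `d ∈ U t^a U / U`, `U = U(c,c)`), theorems otherwise; no named fact, no `sorry`.

The `GL₂` instance of the hypotheses of the exact finite-level control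
(`LevelControlFiniteLevel`, `LevelAction.IsAdaptedFamily`) for the Hida levels
`U = U(c,c) ⊴ U' = U(b',c)` (`b' ≤ c`, `1 ≤ c`, `a ≤ c`, `U` maximal above `p`, `v ∣ p`):

* `TameLevel.normal_subgroupOf_level` — `U(c,c)` is normal in `U(b',c)`;
* `TameLevel.finite_quotient_level` — `U(b',c)/U(c,c)` is finite (open subgroup of a compact group);
* `TameLevel.coe_unipotentFamily_bijOn`, `TameLevel.coe_unipotentFamily_bijOn'` — the family
  `j ↦ N(x_j) t^a` indexed by `U t^a U / U` represents `U t^a U / U` AND `U' t^a U' / U'`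
  bijectively (the criterion `N(x) t^a W = N(x') t^a W ↔ v(x' − x) ≤ |ϖ|^a` does not depend on
  the level `W = U(b,c)`, `globalUnipotent_coset_eq_iff`); [cite: KhareThorne2017, §6.2, Lemma 6.5]
* **`TameLevel.isAdaptedFamily_unipotentFamily`** — it is an adapted family for
  `π : U' → U'/U`: `u N(x_j) t^a = N(x_{σ j}) t^a u'_j` with `u'_j ≡ u mod U`
  (`exists_globalUnipotent_mul_eq`). [cite: KhareThorne2017, §6.3] [cite: Hida1994AIF, §3]

## References

* C. Khare, J. A. Thorne, Amer. J. Math. 139 (2017), §6.2–6.3. [KhareThorne2017]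
* H. Hida, Ann. Inst. Fourier 44 (1994), §3. [Hida1994AIF]
-/

noncomputable section

open scoped NumberField
open IsDedekindDomain

namespace Literature.NumberTheory.Automorphic

namespace BigHeckeGLn

namespace TameLevel

variable {K : Type} [Field K] [NumberField K] {p : ℕ} [Fact p.Prime] (𝒰 : TameLevel 2 K p)
  {v : HeightOneSpectrum (𝓞 K)}

/-- **`U(c,c)` is a normal subgroup of `U(b',c)`** (`b' ≤ c`, `1 ≤ c`). [cite: KhareThorne2017, §6.3] -/
theorem normal_subgroupOf_level (h𝒰 : 𝒰.IsMaximalAbove) {b' c : ℕ} (hb' : b' ≤ c) (hc : 1 ≤ c) :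
    ((𝒰.level c c).subgroupOf (𝒰.level b' c)).Normal := by
  refine (Subgroup.normal_subgroupOf_iff (𝒰.level_antitone hb' le_rfl)).2 fun m l hm hl => ?_
  have h := 𝒰.conj_mem_level_of_mem_level h𝒰 hc (inv_mem hl) hm
  rwa [inv_inv] at h

/-- **`U(b',c)/U(c,c)` is finite.** [folklore] -/
theorem finite_quotient_level (b' c : ℕ) :
    Finite (𝒰.level b' c ⧸ (𝒰.level c c).subgroupOf (𝒰.level b' c)) := by
  haveI : CompactSpace (𝒰.level b' c) := isCompact_iff_compactSpace.1 (𝒰.isCompact_level b' c)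
  exact Subgroup.quotient_finite_of_isOpen _
    ((𝒰.isOpen_level c c).preimage continuous_subtype_val)

/-- The kernel of `π : U(b',c) → U(b',c)/U(c,c)` is `U(c,c)`. [folklore] -/
theorem mem_level_iff_mk'_eq_one {b' c : ℕ} [((𝒰.level c c).subgroupOf (𝒰.level b' c)).Normal]
    (u : 𝒰.level b' c) :
    (u : FiniteAdelicGL 2 K) ∈ 𝒰.level c c ↔
      QuotientGroup.mk' ((𝒰.level c c).subgroupOf (𝒰.level b' c)) u = 1 := by
  rw [QuotientGroup.mk'_apply, QuotientGroup.eq_one_iff, Subgroup.mem_subgroupOf]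

section Family

variable (v)

/-- A chosen integral `x_d` with `N(x_d) t_v^a U(c,c) = d`, for `d ∈ U(c,c) t_v^a U(c,c) / U(c,c)`
(junk `0` otherwise). [cite: KhareThorne2017, §6.2, proof of Lemma 6.5] -/
def unipotentRep (c a : ℕ) (d : FiniteAdelicGL 2 K ⧸ 𝒰.level c c) : v.adicCompletion K :=
  open scoped Classical in
  if h : ∃ x : v.adicCompletion K, Valued.v x ≤ 1 ∧
      ((globalUnipotent K v x * heckeElement 2 K v 1 ^ a : FiniteAdelicGL 2 K) :
        FiniteAdelicGL 2 K ⧸ 𝒰.level c c) = d then h.choose else 0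

variable {v}

/-- Every coset in `U t^a U / U` is `N(x) t^a U` with `x` integral (`a ≤ c`). [folklore] -/
theorem exists_globalUnipotent_coe_eq (h𝒰 : 𝒰.IsMaximalAbove) (hv : (p : 𝓞 K) ∈ v.asIdeal)
    {b c a : ℕ} (ha : a ≤ c) {d : FiniteAdelicGL 2 K ⧸ 𝒰.level b c}
    (hd : d ∈ ArithmeticQuotient.doubleCosetQuot (𝒰.level b c) (heckeElement 2 K v 1 ^ a)) :
    ∃ x : v.adicCompletion K, Valued.v x ≤ 1 ∧
      ((globalUnipotent K v x * heckeElement 2 K v 1 ^ a : FiniteAdelicGL 2 K) :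
        FiniteAdelicGL 2 K ⧸ 𝒰.level b c) = d := by
  obtain ⟨l, hl, rfl⟩ := ArithmeticQuotient.exists_coe_mul_eq_of_mem_doubleCosetQuot _ hd
  obtain ⟨x, hx1, hx⟩ := 𝒰.exists_globalUnipotent_coset_eq h𝒰 hv ha hl
  exact ⟨x, hx1, hx.symm⟩

/-- `N(x) t^a U ∈ U t^a U / U` for `x` integral. [folklore] -/
theorem coe_globalUnipotent_mul_mem_doubleCosetQuot (h𝒰 : 𝒰.IsMaximalAbove)
    (hv : (p : 𝓞 K) ∈ v.asIdeal) (b c a : ℕ) {x : v.adicCompletion K} (hx : Valued.v x ≤ 1) :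
    ((globalUnipotent K v x * heckeElement 2 K v 1 ^ a : FiniteAdelicGL 2 K) :
        FiniteAdelicGL 2 K ⧸ 𝒰.level b c) ∈
      ArithmeticQuotient.doubleCosetQuot (𝒰.level b c) (heckeElement 2 K v 1 ^ a) :=
  ⟨⟨globalUnipotent K v x, (𝒰.globalUnipotent_mem_level_iff h𝒰 hv b c x).2 hx⟩, rfl⟩

/-- The defining properties of `unipotentRep`. [folklore] -/
theorem unipotentRep_spec (h𝒰 : 𝒰.IsMaximalAbove) (hv : (p : 𝓞 K) ∈ v.asIdeal) {c a : ℕ}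
    (ha : a ≤ c) {d : FiniteAdelicGL 2 K ⧸ 𝒰.level c c}
    (hd : d ∈ ArithmeticQuotient.doubleCosetQuot (𝒰.level c c) (heckeElement 2 K v 1 ^ a)) :
    Valued.v (𝒰.unipotentRep v c a d) ≤ 1 ∧
      ((globalUnipotent K v (𝒰.unipotentRep v c a d) * heckeElement 2 K v 1 ^ a :
        FiniteAdelicGL 2 K) : FiniteAdelicGL 2 K ⧸ 𝒰.level c c) = d := by
  have h := 𝒰.exists_globalUnipotent_coe_eq h𝒰 hv ha hd
  rw [unipotentRep, dif_pos h]
  exact h.choose_spec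

/-- **The unipotent family `j ↦ N(x_j) t_v^a`** indexed by `U(c,c) t_v^a U(c,c) / U(c,c)`.
[cite: KhareThorne2017, §6.2] -/
abbrev unipotentFamily (c a : ℕ)
    (j : ArithmeticQuotient.doubleCosetQuot (𝒰.level c c) (heckeElement 2 K v 1 ^ a)) :
    FiniteAdelicGL 2 K :=
  globalUnipotent K v (𝒰.unipotentRep v c a j) * heckeElement 2 K v 1 ^ a

/-- The index set `U t^a U / U` is finite. [folklore] -/
instance fintypeDoubleCosetQuot (c a : ℕ) :
    Fintype (ArithmeticQuotient.doubleCosetQuot (𝒰.level c c) (heckeElement 2 K v 1 ^ a)) :=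
  (finite_orbit_quotient (𝒰.level c c) (heckeElement 2 K v 1 ^ a)).fintype

/-- **The unipotent family represents `U t^a U / U` bijectively** (`U = U(c,c)`, `a ≤ c`).
[cite: KhareThorne2017, §6.2, Lemma 6.5] -/
theorem coe_unipotentFamily_bijOn (h𝒰 : 𝒰.IsMaximalAbove) (hv : (p : 𝓞 K) ∈ v.asIdeal)
    {c a : ℕ} (ha : a ≤ c) :
    Set.BijOn (fun j => ((𝒰.unipotentFamily (v := v) c a j : FiniteAdelicGL 2 K) :
        FiniteAdelicGL 2 K ⧸ 𝒰.level c c)) Set.univ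
      (ArithmeticQuotient.doubleCosetQuot (𝒰.level c c) (heckeElement 2 K v 1 ^ a)) := by
  refine ⟨fun j _ => ?_, fun j₁ _ j₂ _ h => ?_, fun d hd => ?_⟩
  · change ((𝒰.unipotentFamily c a j : FiniteAdelicGL 2 K) : FiniteAdelicGL 2 K ⧸ 𝒰.level c c) ∈ _
    rw [unipotentFamily, (𝒰.unipotentRep_spec h𝒰 hv ha j.2).2]
    exact j.2
  · simp only at h
    rw [(𝒰.unipotentRep_spec h𝒰 hv ha j₁.2).2, (𝒰.unipotentRep_spec h𝒰 hv ha j₂.2).2] at h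
    exact Subtype.ext h
  · exact ⟨⟨d, hd⟩, Set.mem_univ _, (𝒰.unipotentRep_spec h𝒰 hv ha hd).2⟩

/-- **… and `U' t^a U' / U'` bijectively** (`U' = U(b',c)`, `a ≤ c`): the coset criterion
`N(x) t^a W = N(x') t^a W ↔ v(x' − x) ≤ |ϖ_v|^a` does not depend on the level `W`.
[cite: KhareThorne2017, §6.2, Lemma 6.5] -/
theorem coe_unipotentFamily_bijOn' (h𝒰 : 𝒰.IsMaximalAbove) (hv : (p : 𝓞 K) ∈ v.asIdeal)
    {b' c a : ℕ} (ha : a ≤ c) :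
    Set.BijOn (fun j => ((𝒰.unipotentFamily (v := v) c a j : FiniteAdelicGL 2 K) :
        FiniteAdelicGL 2 K ⧸ 𝒰.level b' c)) Set.univ
      (ArithmeticQuotient.doubleCosetQuot (𝒰.level b' c) (heckeElement 2 K v 1 ^ a)) := by
  refine ⟨fun j _ => ?_, fun j₁ _ j₂ _ h => ?_, fun d hd => ?_⟩
  · exact 𝒰.coe_globalUnipotent_mul_mem_doubleCosetQuot h𝒰 hv b' c a
      (𝒰.unipotentRep_spec h𝒰 hv ha j.2).1
  · simp only at h
    rw [𝒰.globalUnipotent_coset_eq_iff h𝒰 hv] at h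
    rw [← 𝒰.globalUnipotent_coset_eq_iff h𝒰 hv c c] at h
    rw [(𝒰.unipotentRep_spec h𝒰 hv ha j₁.2).2, (𝒰.unipotentRep_spec h𝒰 hv ha j₂.2).2] at h
    exact Subtype.ext h
  · obtain ⟨y, hy1, hy⟩ := 𝒰.exists_globalUnipotent_coe_eq h𝒰 hv ha hd
    set j : ArithmeticQuotient.doubleCosetQuot (𝒰.level c c) (heckeElement 2 K v 1 ^ a) :=
      ⟨_, 𝒰.coe_globalUnipotent_mul_mem_doubleCosetQuot h𝒰 hv c c a hy1⟩ with hj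
    refine ⟨j, Set.mem_univ _, ?_⟩
    simp only
    rw [← hy, 𝒰.globalUnipotent_coset_eq_iff h𝒰 hv, ← 𝒰.globalUnipotent_coset_eq_iff h𝒰 hv c c,
      (𝒰.unipotentRep_spec h𝒰 hv ha j.2).2]

/-- **The unipotent family is adapted to `π : U(b',c) → U(b',c)/U(c,c)`**: for `u ∈ U(b',c)`,
`u · N(x_j) t^a = N(x_{σ j}) t^a · u'_j` with `u'_j ∈ U(b',c)`, `π(u'_j) = π(u)`, `σ` a permutation
(`b' ≤ c`, `1 ≤ c`, `a ≤ c`; `Δ` any monoid containing the family). [cite: KhareThorne2017, §6.3]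
[cite: Hida1994AIF, §3] -/
theorem isAdaptedFamily_unipotentFamily (h𝒰 : 𝒰.IsMaximalAbove) (hv : (p : 𝓞 K) ∈ v.asIdeal)
    {b' c a : ℕ} (ha : a ≤ c) (hb' : b' ≤ c) (hc : 1 ≤ c)
    [((𝒰.level c c).subgroupOf (𝒰.level b' c)).Normal]
    {Δ : Submonoid (FiniteAdelicGL 2 K)} (hΔ : ∀ j, 𝒰.unipotentFamily (v := v) c a j ∈ Δ) :
    LevelAction.IsAdaptedFamily Δ (𝒰.level b' c)
      (QuotientGroup.mk' ((𝒰.level c c).subgroupOf (𝒰.level b' c)))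
      (𝒰.unipotentFamily (v := v) c a) := by
  classical
  set U := 𝒰.level c c with hU
  set U' := 𝒰.level b' c with hU'
  set t : FiniteAdelicGL 2 K := heckeElement 2 K v 1 ^ a with ht
  have hle : U ≤ U' := 𝒰.level_antitone hb' le_rfl
  refine ⟨hΔ, fun u => ?_⟩
  -- for each `j`: `u a_j = N(x'_j) t u'_j`
  have step : ∀ j : ArithmeticQuotient.doubleCosetQuot U t,
      ∃ (j' : ArithmeticQuotient.doubleCosetQuot U t) (w : U'),
        (u : FiniteAdelicGL 2 K) * 𝒰.unipotentFamily c a j = 𝒰.unipotentFamily c a j' * w ∧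
        QuotientGroup.mk' (U.subgroupOf U') w = QuotientGroup.mk' (U.subgroupOf U') u := by
    intro j
    obtain ⟨x', u', hx'1, hu'U', hu', heq⟩ := 𝒰.exists_globalUnipotent_mul_eq h𝒰 hv ha hb' hc u.2
      (𝒰.unipotentRep_spec h𝒰 hv ha j.2).1
    -- `N(x') t ≡ a_{j'} mod U`
    set j' : ArithmeticQuotient.doubleCosetQuot U t :=
      ⟨_, 𝒰.coe_globalUnipotent_mul_mem_doubleCosetQuot h𝒰 hv c c a hx'1⟩ with hj'
    have hj'eq : ((𝒰.unipotentFamily c a j' : FiniteAdelicGL 2 K) : FiniteAdelicGL 2 K ⧸ U) =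
        ((globalUnipotent K v x' * t : FiniteAdelicGL 2 K) : FiniteAdelicGL 2 K ⧸ U) :=
      (𝒰.unipotentRep_spec h𝒰 hv ha j'.2).2
    set u₀ : FiniteAdelicGL 2 K := (𝒰.unipotentFamily c a j')⁻¹ * (globalUnipotent K v x' * t) with hu₀
    have hu₀U : u₀ ∈ U := by
      rw [hu₀, ← QuotientGroup.eq]
      exact hj'eq
    have hkey : 𝒰.unipotentFamily c a j' * u₀ = globalUnipotent K v x' * t := by
      rw [hu₀, mul_inv_cancel_left]
    refine ⟨j', ⟨u₀ * u', mul_mem (hle hu₀U) hu'U'⟩, ?_, ?_⟩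
    · rw [heq, ← hkey, mul_assoc]
    · rw [QuotientGroup.mk'_apply, QuotientGroup.mk'_apply, QuotientGroup.eq, Subgroup.mem_subgroupOf]
      change (u₀ * u')⁻¹ * (u : FiniteAdelicGL 2 K) ∈ U
      have h1 : u'⁻¹ * u₀⁻¹ * u' ∈ U := 𝒰.conj_mem_level_of_mem_level h𝒰 hc hu'U' (inv_mem hu₀U)
      have h2 : u'⁻¹ * (u : FiniteAdelicGL 2 K) ∈ U := by simpa using inv_mem hu'
      have h3 := mul_mem h1 h2
      rwa [show u'⁻¹ * u₀⁻¹ * u' * (u'⁻¹ * (u : FiniteAdelicGL 2 K)) =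
        (u₀ * u')⁻¹ * (u : FiniteAdelicGL 2 K) by group] at h3
  choose f w hfw hπ using step
  -- `f` is injective (compare cosets modulo `U'`), hence a permutation
  have hinj : Function.Injective f := by
    intro j₁ j₂ h
    have e₁ := hfw j₁
    have e₂ := hfw j₂
    rw [h] at e₁
    have hcoset : ((𝒰.unipotentFamily c a j₁ : FiniteAdelicGL 2 K) : FiniteAdelicGL 2 K ⧸ U') =
        ((𝒰.unipotentFamily c a j₂ : FiniteAdelicGL 2 K) : FiniteAdelicGL 2 K ⧸ U') := by
      rw [QuotientGroup.eq]
      have : (𝒰.unipotentFamily c a j₁)⁻¹ * 𝒰.unipotentFamily c a j₂ =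
          (w j₁ : FiniteAdelicGL 2 K)⁻¹ * (w j₂ : FiniteAdelicGL 2 K) := by
        have h₁ : 𝒰.unipotentFamily c a j₁ = (u : FiniteAdelicGL 2 K)⁻¹ *
            (𝒰.unipotentFamily c a (f j₂) * w j₁) := by rw [← e₁, inv_mul_cancel_left]
        have h₂ : 𝒰.unipotentFamily c a j₂ = (u : FiniteAdelicGL 2 K)⁻¹ *
            (𝒰.unipotentFamily c a (f j₂) * w j₂) := by rw [← e₂, inv_mul_cancel_left]
        rw [h₁, h₂]
        group
      rw [this]
      exact mul_mem (inv_mem (w j₁).2) (w j₂).2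
    exact (𝒰.coe_unipotentFamily_bijOn' h𝒰 hv (b' := b') ha).injOn (Set.mem_univ _) (Set.mem_univ _)
      hcoset
  refine ⟨Equiv.ofBijective f (Finite.injective_iff_bijective.1 hinj), fun j => ⟨w j, ?_, hπ j⟩⟩
  rw [Equiv.ofBijective_apply]
  exact hfw j

end Family

end TameLevel

end BigHeckeGLn

end Literature.NumberTheory.Automorphic
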